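import Literature.NumberTheory.EllipticCurves.ZpExtensionEisensteinTwistDualPerfect
import Literature.NumberTheory.EllipticCurves.IwasawaAlgebraEisensteinQuotientReciprocity
import HarnessLib

/-!
# The `A_{m,k}`-valued duality form on Howard's Eisenstein levels `M ⊗ A_{m,k}(ψ)`: symmetry, perfectness and
# `(s^g, t^{τgτ⁻¹})`-equivariance — the fields of hypothesis H.4 in `R`-valued currency (`R = A_{m,k}`)

Topic `NumberTheory/EllipticCurves` (sequel to `ZpExtensionEisensteinTwistDual(Perfect)`,
`IwasawaAlgebraEisensteinQuotientReciprocity`; definitions with bodies + theorems; no named fact, no instance,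
no notation, no `sorry`).

The cell's typed form of Howard 2004, §1.3 H.4 (`Literature.NumberTheory.GaloisCohomology.Howard2004.DualityDatum`,
lit g30 (W9)-A tranche 2) carries, on a level module `M` over the level ring `R`, an `R`-bilinear
`e : M →ₗ[R] M →ₗ[R] R` that is SYMMETRIC, PERFECT (`Function.Bijective ⇑e`) and satisfies
`e (ρ g s) (ρ (τ g τ⁻¹) t) = algebraMap ℤ_[p] R (χ_cyc g) * e s t`. For the Eisenstein levels
`T_𝔮/p^k T_𝔮 = E[p^k] ⊗ A_{m,k}(ψ)` (tree `ZpExtension.eisensteinTwist`, `R = A_{m,k} = Λ/(T^m + p, p^k)`) this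
file constructs that `e` from an `E`-level datum and proves the three properties:

* §1 the level ring: `EisensteinCoeff.charP` (`A_{m,k}` has characteristic `p^k`, `m ≥ 1`),
  `EisensteinCoeff.ofZMod : ZMod (p^k) →+* A_{m,k}`, `algebraMap_padicInt_eq_ofZMod_toZModPow`
  (`ℤ_p → A_{m,k}` is `ℤ_p → ℤ/p^k → A_{m,k}`), `tailFormZMod_ofZMod_mul` (`λ_k(ι(x) c) = x λ_k(c)`);
* §2 (any commutative `𝒪`, `ι : ℤ/n →+* 𝒪`, bi-additive `eb : M₁ × M₂ → ℤ/n`) the `𝒪`-BILINEAR form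
  **`scalarForm ι eb : (𝒪 ⊗ M₁) →ₗ[𝒪] (𝒪 ⊗ M₂) →ₗ[𝒪] 𝒪`, `(c₁ ⊗ a₁, c₂ ⊗ a₂) ↦ c₁ c₂ ι(eb(a₁, a₂))`**
  (Howard's `e_𝔮(t₁ ⊗ α₁, t₂ ⊗ α₂) = e(t₁, t₂^τ) α₁ α₂`, Lemma 2.1.1), `scalarForm_tmul_tmul`, symmetry
  transfer `scalarForm_flip`, and the link with the `λ`-contracted pairing of `ZpExtensionEisensteinTwistDual`:
  `lam (scalarForm ι eb x y) = coeffPairing lam eb x y` when `lam (ι z * c) = z * lam c` (`apply_scalarForm_eq_coeffPairing`);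
* §3 (`𝒪 = A_{m,k}`, `ι = ofZMod`, generic `p^k`-torsion value group `P`) the dual map of the `λ_k`-contracted
  pairing in the FIRST slot is injective / surjective under left-non-degeneracy / left-exhaustion of `eb`
  (`coeffPairing_left_injective`, `coeffPairing_left_surjective`; coordinates `[T^i] ⊗ ·` and the tail-form
  dual family `[πᵢ^*]` of `ZpExtensionEisensteinTwistDualPerfect`), hence **`eisensteinDualityForm_bijective`**:
  the `A_{m,k}`-valued form is PERFECT in the `R`-valued sense (`Function.Bijective ⇑e`, via the reciprocity
  `bijective_iff_bijective_tailFormZModComp_comp`);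
* §4 symmetry (`eisensteinDualityForm_symm`) and **equivariance `eisensteinDualityForm_equivariant`** for ONE twist
  `κ'.eisensteinTwist ρ` on both slots with the conjugation `c : Γ_K → Γ_K` on the second, given the `E`-level
  equivariance `eb (ρ g a) (ρ (c g) b) = χ̄(g) eb a b` and OPPOSITE exponents `p^J ∣ e_J^{κ'}(g) + e_J^{κ'}(c g)`
  (`twistExponent_add_twistExponent_conj_dvd`: automatic when `κ'(c g) = κ'(g)⁻¹`, i.e. `κ'` anticyclotomic for
  `c`); in the cyclotomic normalisation `χ̄ = χ_cyc mod p^k` the right-hand side is literally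
  `algebraMap ℤ_[p] A_{m,k} (χ_cyc g) * e s t` (`eisensteinDualityForm_equivariant_cyclotomic`).

What is NOT here: the packaging as a `Howard2004.DualityDatum` (it needs `[TopologicalSpace A_{m,k}]`,
`[DiscreteTopology A_{m,k}]` instances and the rank-one module `twistOne` on the level ring — the tree has no
topology instance on `EisensteinCoeff` yet; whoever fixes the level-ring carrier packages the four fields from
this file in a dozen lines), the local self-orthogonality clause of H.4 (needs the Selmer structure `F_𝔮`), and
the identification of the `E`-level datum with the Weil pairing composed with `τ` (an instantiation).
BSD is not proved by any of this.

References: [Howard2004HeegnerKolyvagin] B. Howard, Compositio Math. 140 (2004), §1.3 (H.4), Lemma 2.1.1, §2.1, §2.2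
(proof of Thm. 2.2.10, `𝔮 = T^m + p`); [MazurRubin2004] §1.3, §5.3; [Washington1997] §13.2.
-/

noncomputable section

open scoped TensorProduct
open Field

universe u v w₁ w₂

namespace Literature.NumberTheory.EllipticCurves

open Literature.NumberTheory.GaloisRepresentations Literature.RingTheory.CompleteIntersection

/-! ## §1 The level ring `A_{m,k}`: characteristic `p^k`, `ℤ/p^k → A_{m,k}`, `ℤ_p → A_{m,k}` -/

namespace IwasawaAlgebra

variable (p : ℕ) [hp : Fact p.Prime]

/-- `λ_k([π₀^*]) = 1`: the tail form of `A_{m,k}` takes the value `1` (`m ≥ 1`). [cite: DeSmitRubinSchoof1997, Cor. 2.2 (case n = 1)] -/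
theorem EisensteinCoeff.tailFormZMod_dualFamily_zero {m : ℕ} (hm : 1 ≤ m) (k : ℕ) :
    EisensteinCoeff.tailFormZMod p hm k (EisensteinCoeff.dualFamily p hm k ⟨0, hm⟩) = 1 := by
  have h := EisensteinCoeff.tailFormZMod_dualFamily_mul_mk_X_pow p hm k ⟨0, hm⟩ ⟨0, hm⟩
  rwa [if_pos rfl, pow_zero, map_one, mul_one] at h

/-- **`A_{m,k} = Λ/(T^m + p, p^k)` has characteristic `p^k`** (`m ≥ 1`): `p^k = 0`, and if `n = 0` in `A_{m,k}` then
`n = n · λ_k([π₀^*]) = λ_k(n [π₀^*]) = 0` in `ℤ/p^k`. [cite: Washington1997, §13.2] [cite: Howard2004HeegnerKolyvagin, §2.2 (A_𝔮/p^k)] -/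
theorem EisensteinCoeff.charP {m : ℕ} (hm : 1 ≤ m) (k : ℕ) : CharP (EisensteinCoeff p m k) (p ^ k) := by
  refine ⟨fun x => ⟨fun hx => ?_, fun hdvd => ?_⟩⟩
  · rw [← ZMod.natCast_eq_zero_iff]
    have h1 : (x : ZMod (p ^ k)) = x • EisensteinCoeff.tailFormZMod p hm k (EisensteinCoeff.dualFamily p hm k ⟨0, hm⟩) := by
      rw [EisensteinCoeff.tailFormZMod_dualFamily_zero, nsmul_eq_mul, mul_one]
    rw [h1, ← map_nsmul, nsmul_eq_mul, hx, zero_mul, map_zero]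
  · obtain ⟨t, rfl⟩ := hdvd
    rw [Nat.cast_mul, Nat.cast_pow, natCast_pow_eq_zero_quotient p m k, zero_mul]

/-- **`ι : ℤ/p^k →+* A_{m,k}`**, the structure map of the `ℤ/p^k`-algebra `A_{m,k}` (Mathlib `ZMod.castHom` at the
characteristic `p^k`). [cite: Howard2004HeegnerKolyvagin, §2.2 (A_𝔮/p^k)] -/
def EisensteinCoeff.ofZMod {m : ℕ} (hm : 1 ≤ m) (k : ℕ) : ZMod (p ^ k) →+* EisensteinCoeff p m k :=
  haveI := EisensteinCoeff.charP p hm k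
  ZMod.castHom (dvd_refl (p ^ k)) (EisensteinCoeff p m k)

/-- `ι(x) = x.val` (as a natural-number cast). [cite: Washington1997, §13.2] -/
theorem EisensteinCoeff.ofZMod_apply {m : ℕ} (hm : 1 ≤ m) (k : ℕ) (x : ZMod (p ^ k)) :
    EisensteinCoeff.ofZMod p hm k x = (x.val : EisensteinCoeff p m k) := by
  haveI := EisensteinCoeff.charP p hm k
  rw [EisensteinCoeff.ofZMod, ZMod.castHom_apply, ZMod.cast_eq_val]

/-- **`ℤ_p → A_{m,k}` factors through `ℤ/p^k`**: `algebraMap ℤ_[p] A_{m,k} z = ι(z mod p^k)` (the structure map of the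
`ℤ_p`-algebra `A_{m,k} = Λ/(q_m, p^k)` versus `PadicInt.toZModPow`). [cite: Washington1997, §13.2]
[cite: Howard2004HeegnerKolyvagin, §2.2 (A_𝔮/p^k)] -/
theorem EisensteinCoeff.algebraMap_padicInt_eq_ofZMod_toZModPow {m : ℕ} (hm : 1 ≤ m) (k : ℕ) (z : ℤ_[p]) :
    algebraMap ℤ_[p] (EisensteinCoeff p m k) z = EisensteinCoeff.ofZMod p hm k (PadicInt.toZModPow k z) := by
  obtain ⟨d, hd⟩ := Ideal.mem_span_singleton'.mp (PadicInt.appr_spec k z)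
  have hz : z = ((z.appr k : ℕ) : ℤ_[p]) + d * (p : ℤ_[p]) ^ k := by rw [hd]; ring
  have htz : PadicInt.toZModPow k z = ((z.appr k : ℕ) : ZMod (p ^ k)) := rfl
  have hL : algebraMap ℤ_[p] (EisensteinCoeff p m k) z =
      Ideal.Quotient.mk _ (PowerSeries.C z) := by
    rw [← Ideal.Quotient.mk_algebraMap, PowerSeries.algebraMap_eq]
  have hn : (Ideal.Quotient.mk (Ideal.span {(PowerSeries.X ^ m + PowerSeries.C (p : ℤ_[p]) : IwasawaAlgebra p)} ⊔
      Ideal.span {PowerSeries.C ((p : ℤ_[p]) ^ k)})) (PowerSeries.C ((z.appr k : ℕ) : ℤ_[p])) =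
      ((z.appr k : ℕ) : EisensteinCoeff p m k) :=
    map_natCast ((Ideal.Quotient.mk _).comp (PowerSeries.C (R := ℤ_[p]))) (z.appr k)
  rw [htz, map_natCast (EisensteinCoeff.ofZMod p hm k), hL]
  conv_lhs => rw [hz]
  rw [map_add (PowerSeries.C (R := ℤ_[p])), map_add (Ideal.Quotient.mk _), hn, add_eq_left,
    map_mul (PowerSeries.C (R := ℤ_[p])), Ideal.Quotient.eq_zero_iff_mem]
  exact Ideal.mem_sup_right (Ideal.mul_mem_left _ _ (Ideal.mem_span_singleton_self _))

/-- **`λ_k(ι(x) · c) = x · λ_k(c)`**: the tail form is `ℤ/p^k`-linear. [cite: Howard2004HeegnerKolyvagin, §2.1 and §2.2] -/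
theorem EisensteinCoeff.tailFormZMod_ofZMod_mul {m : ℕ} (hm : 1 ≤ m) (k : ℕ) (x : ZMod (p ^ k)) (c : EisensteinCoeff p m k) :
    EisensteinCoeff.tailFormZMod p hm k (EisensteinCoeff.ofZMod p hm k x * c) =
      x * EisensteinCoeff.tailFormZMod p hm k c := by
  rw [EisensteinCoeff.ofZMod_apply, ← nsmul_eq_mul, map_nsmul, nsmul_eq_mul, ZMod.natCast_zmod_val]

end IwasawaAlgebra

/-! ## §2 The `𝒪`-bilinear scalar form `(c₁ ⊗ a₁, c₂ ⊗ a₂) ↦ c₁ c₂ ι(eb(a₁, a₂))` -/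

section ScalarForm

variable {𝒪 : Type v} [CommRing 𝒪] {n : ℕ} (ι : ZMod n →+* 𝒪)
  {M₁ : Type w₁} {M₂ : Type w₂} [AddCommGroup M₁] [AddCommGroup M₂] (eb : M₁ →+ M₂ →+ ZMod n)

/-- The contraction `𝒪 ⊗_ℤ ℤ/n → 𝒪`, `c ⊗ x ↦ c · ι(x)`. [cite: Howard2004HeegnerKolyvagin, Lemma 2.1.1] -/
def scalarContract : 𝒪 ⊗[ℤ] ZMod n →ₗ[ℤ] 𝒪 :=
  TensorProduct.lift (LinearMap.mk₂ ℤ (fun c x => c * ι x) (fun c c' x => add_mul c c' _)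
    (fun z c x => by rw [smul_mul_assoc]) (fun c x x' => by rw [map_add, mul_add])
    (fun z c x => by rw [map_zsmul ι z x, mul_smul_comm]))

/-- Unfolding: `scalarContract (c ⊗ x) = c * ι x`. [cite: Howard2004HeegnerKolyvagin, Lemma 2.1.1] -/
@[simp]
theorem scalarContract_tmul (c : 𝒪) (x : ZMod n) : scalarContract ι (c ⊗ₜ[ℤ] x) = c * ι x :=
  TensorProduct.lift.tmul _ _

/-- The scalar form as a `ℤ`-bilinear map on Mathlib's tensor products (`TensorProduct.map₂` of the multiplication
and of `eb`, contracted by `ι`). [cite: Howard2004HeegnerKolyvagin, Lemma 2.1.1 (e_𝔭(t₁ ⊗ α₁, t₂ ⊗ α₂) = e(t₁, t₂^τ) ⊗ α₁α₂)] -/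
def scalarFormLin : 𝒪 ⊗[ℤ] M₁ →ₗ[ℤ] 𝒪 ⊗[ℤ] M₂ →ₗ[ℤ] 𝒪 :=
  (TensorProduct.map₂ (LinearMap.mul ℤ 𝒪) (AddMonoidHom.toIntBilin eb)).compr₂ (scalarContract ι)

/-- Unfolding on pure tensors: `scalarFormLin (c₁ ⊗ a₁) (c₂ ⊗ a₂) = c₁ * c₂ * ι (eb a₁ a₂)`. [cite: Howard2004HeegnerKolyvagin, Lemma 2.1.1] -/
@[simp]
theorem scalarFormLin_tmul_tmul (c₁ c₂ : 𝒪) (a₁ : M₁) (a₂ : M₂) :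
    scalarFormLin ι eb (c₁ ⊗ₜ[ℤ] a₁) (c₂ ⊗ₜ[ℤ] a₂) = c₁ * c₂ * ι (eb a₁ a₂) := by
  rw [scalarFormLin, LinearMap.compr₂_apply, TensorProduct.map₂_apply_tmul, TensorProduct.map_tmul, scalarContract_tmul]
  rfl

/-- The scalar form on the tree's carriers `CoeffExtension ℤ 𝒪 Mᵢ` as a bi-additive map (auxiliary).
[cite: Howard2004HeegnerKolyvagin, Lemma 2.1.1] -/
def scalarFormHom : CoeffExtension ℤ 𝒪 M₁ →+ CoeffExtension ℤ 𝒪 M₂ →+ 𝒪 :=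
  (LinearMap.toAddMonoidHom' : (𝒪 ⊗[ℤ] M₂ →ₗ[ℤ] 𝒪) →+ (𝒪 ⊗[ℤ] M₂ →+ 𝒪)).comp (scalarFormLin ι eb).toAddMonoidHom

/-- Unfolding on pure tensors: `scalarFormHom (c₁ ⊗ a₁) (c₂ ⊗ a₂) = c₁ * c₂ * ι (eb a₁ a₂)`. [cite: Howard2004HeegnerKolyvagin, Lemma 2.1.1] -/
@[simp]
theorem scalarFormHom_tmul_tmul (c₁ c₂ : 𝒪) (a₁ : M₁) (a₂ : M₂) :
    scalarFormHom ι eb (CoeffExtension.tmul c₁ a₁) (CoeffExtension.tmul c₂ a₂) = c₁ * c₂ * ι (eb a₁ a₂) :=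
  scalarFormLin_tmul_tmul ι eb c₁ c₂ a₁ a₂

/-- `𝒪`-linearity in the first slot: `F(c • x, y) = c * F(x, y)`. [cite: Howard2004HeegnerKolyvagin, Lemma 2.1.1 («S_𝔭-bilinear»)] -/
theorem scalarFormHom_smul_left (c : 𝒪) (x : CoeffExtension ℤ 𝒪 M₁) (y : CoeffExtension ℤ 𝒪 M₂) :
    scalarFormHom ι eb (c • x) y = c * scalarFormHom ι eb x y := by
  induction x using CoeffExtension.induction_on with
  | zero => rw [smul_zero, map_zero, AddMonoidHom.zero_apply, mul_zero]
  | tmul c₁ a₁ =>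
    induction y using CoeffExtension.induction_on with
    | zero => rw [map_zero, map_zero, mul_zero]
    | tmul c₂ a₂ =>
      rw [show c • (CoeffExtension.tmul c₁ a₁ : CoeffExtension ℤ 𝒪 M₁) = CoeffExtension.tmul (c * c₁) a₁ from
          TensorProduct.smul_tmul' c c₁ a₁, scalarFormHom_tmul_tmul, scalarFormHom_tmul_tmul]
      ring
    | add y y' hy hy' => rw [map_add, map_add, hy, hy', mul_add]
  | add x x' hx hx' =>
    rw [smul_add, map_add, map_add, AddMonoidHom.add_apply, AddMonoidHom.add_apply, hx, hx', mul_add]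

/-- `𝒪`-linearity in the second slot: `F(x, c • y) = c * F(x, y)`. [cite: Howard2004HeegnerKolyvagin, Lemma 2.1.1 («S_𝔭-bilinear»)] -/
theorem scalarFormHom_smul_right (c : 𝒪) (x : CoeffExtension ℤ 𝒪 M₁) (y : CoeffExtension ℤ 𝒪 M₂) :
    scalarFormHom ι eb x (c • y) = c * scalarFormHom ι eb x y := by
  induction x using CoeffExtension.induction_on with
  | zero => rw [map_zero, AddMonoidHom.zero_apply, AddMonoidHom.zero_apply, mul_zero]
  | tmul c₁ a₁ =>
    induction y using CoeffExtension.induction_on with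
    | zero => rw [smul_zero, map_zero, mul_zero]
    | tmul c₂ a₂ =>
      rw [show c • (CoeffExtension.tmul c₂ a₂ : CoeffExtension ℤ 𝒪 M₂) = CoeffExtension.tmul (c * c₂) a₂ from
          TensorProduct.smul_tmul' c c₂ a₂, scalarFormHom_tmul_tmul, scalarFormHom_tmul_tmul]
      ring
    | add y y' hy hy' => rw [smul_add, map_add, map_add, hy, hy', mul_add]
  | add x x' hx hx' =>
    rw [map_add, AddMonoidHom.add_apply, AddMonoidHom.add_apply, hx, hx', mul_add]

/-- **The `𝒪`-BILINEAR scalar form** `(𝒪 ⊗ M₁) × (𝒪 ⊗ M₂) → 𝒪`, `(c₁ ⊗ a₁, c₂ ⊗ a₂) ↦ c₁ c₂ ι(eb(a₁, a₂))` — Howard's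
`e_𝔮` at a finite level when `eb` is (a trivialisation of) `e_Weil(·, ·^τ)`. [cite: Howard2004HeegnerKolyvagin, Lemma 2.1.1] -/
def scalarForm : CoeffExtension ℤ 𝒪 M₁ →ₗ[𝒪] CoeffExtension ℤ 𝒪 M₂ →ₗ[𝒪] 𝒪 :=
  LinearMap.mk₂ 𝒪 (fun x y => scalarFormHom ι eb x y) (fun x x' y => by rw [map_add, AddMonoidHom.add_apply])
    (fun c x y => by rw [scalarFormHom_smul_left, smul_eq_mul]) (fun x y y' => map_add _ _ _)
    (fun c x y => by rw [scalarFormHom_smul_right, smul_eq_mul])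

/-- Unfolding: `scalarForm ι eb x y = scalarFormHom ι eb x y`. [cite: Howard2004HeegnerKolyvagin, Lemma 2.1.1] -/
@[simp]
theorem scalarForm_apply_apply (x : CoeffExtension ℤ 𝒪 M₁) (y : CoeffExtension ℤ 𝒪 M₂) :
    scalarForm ι eb x y = scalarFormHom ι eb x y := rfl

/-- **Unfolding on pure tensors**: `scalarForm (c₁ ⊗ a₁) (c₂ ⊗ a₂) = c₁ * c₂ * ι (eb a₁ a₂)`. [cite: Howard2004HeegnerKolyvagin, Lemma 2.1.1] -/
theorem scalarForm_tmul_tmul (c₁ c₂ : 𝒪) (a₁ : M₁) (a₂ : M₂) :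
    scalarForm ι eb (CoeffExtension.tmul c₁ a₁) (CoeffExtension.tmul c₂ a₂) = c₁ * c₂ * ι (eb a₁ a₂) :=
  scalarFormHom_tmul_tmul ι eb c₁ c₂ a₁ a₂

/-- Symmetry transfer: if `eb'(b, a) = eb(a, b)` then `scalarForm ι eb' y x = scalarForm ι eb x y`.
[cite: Howard2004HeegnerKolyvagin, §1.3 (H.4, «symmetric»)] -/
theorem scalarForm_flip (eb' : M₂ →+ M₁ →+ ZMod n) (heb' : ∀ a b, eb' b a = eb a b) (x : CoeffExtension ℤ 𝒪 M₁)
    (y : CoeffExtension ℤ 𝒪 M₂) : scalarForm ι eb' y x = scalarForm ι eb x y := by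
  rw [scalarForm_apply_apply, scalarForm_apply_apply]
  induction x using CoeffExtension.induction_on with
  | zero => rw [map_zero, map_zero, AddMonoidHom.zero_apply]
  | tmul c₁ a₁ =>
    induction y using CoeffExtension.induction_on with
    | zero => rw [map_zero, AddMonoidHom.zero_apply, map_zero]
    | tmul c₂ a₂ => rw [scalarFormHom_tmul_tmul, scalarFormHom_tmul_tmul, heb', mul_comm c₂ c₁]
    | add y y' hy hy' => rw [map_add, AddMonoidHom.add_apply, map_add, hy, hy']
  | add x x' hx hx' => rw [map_add, map_add, AddMonoidHom.add_apply, hx, hx']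

/-- **Link with the `λ`-contracted pairing**: for an additive `lam : 𝒪 → ℤ/n` with `lam(ι(z) c) = z · lam(c)`,
`lam (scalarForm ι eb x y) = coeffPairing lam eb x y` (the latter from `ZpExtensionEisensteinTwistDual`, values in the
`n`-torsion group `ℤ/n`). [cite: Howard2004HeegnerKolyvagin, §2.1 (Hom_{S_𝔭}(N, 𝒟_𝔭(1)) ≅ Hom_{ℤ_p}(N, μ_{p^∞})) and Lemma 2.1.1] -/
theorem apply_scalarForm_eq_coeffPairing [NeZero n] (lam : 𝒪 →+ ZMod n) (hlam : ∀ (z : ZMod n) (c : 𝒪), lam (ι z * c) = z * lam c)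
    (x : CoeffExtension ℤ 𝒪 M₁) (y : CoeffExtension ℤ 𝒪 M₂) :
    lam (scalarForm ι eb x y) = coeffPairing lam eb (fun q : ZMod n => by
      rw [nsmul_eq_mul, ZMod.natCast_self, zero_mul]) x y := by
  rw [scalarForm_apply_apply]
  induction x using CoeffExtension.induction_on with
  | zero => rw [map_zero, AddMonoidHom.zero_apply, map_zero, map_zero, AddMonoidHom.zero_apply]
  | tmul c₁ a₁ =>
    induction y using CoeffExtension.induction_on with
    | zero => rw [map_zero, map_zero, map_zero]
    | tmul c₂ a₂ =>
      rw [scalarFormHom_tmul_tmul, coeffPairing_tmul_tmul, mul_comm (c₁ * c₂), hlam, nsmul_eq_mul, ZMod.natCast_zmod_val,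
        mul_comm]
    | add y y' hy hy' => rw [map_add, map_add, map_add, hy, hy']
  | add x x' hx hx' => rw [map_add, AddMonoidHom.add_apply, map_add, map_add, AddMonoidHom.add_apply, hx, hx']

end ScalarForm

/-! ## §3 The Eisenstein levels: the form is perfect in the `R`-valued sense -/

namespace ZpExtension

open IwasawaAlgebra

section Perfect

variable {p : ℕ} [hp : Fact p.Prime] {m : ℕ} (hm : 1 ≤ m) (k : ℕ)
  {M₁ : Type} {M₂ : Type} [AddCommGroup M₁] [AddCommGroup M₂] {P : Type} [AddCommGroup P]
  (e : M₁ →+ M₂ →+ P) (hP : ∀ q : P, (p ^ k) • q = 0)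

/-- **Injectivity of the FIRST-slot dual map** `x ↦ B(x, ·)` of the `λ_k`-contracted pairing, for `e`
LEFT-non-degenerate (coordinates `x = ∑ᵢ [T^i] ⊗ wᵢ`, test vectors `[πⱼ^*] ⊗ b`).
[cite: Howard2004HeegnerKolyvagin, §1.3 (H.4, «perfect») and Lemma 2.1.1] -/
theorem coeffPairing_left_injective (he : ∀ w : M₁, (∀ b : M₂, e w b = 0) → w = 0)
    {x : EisensteinCoeff.Twisted p m k M₁}
    (hx : ∀ y, coeffPairing (EisensteinCoeff.tailFormZMod p hm k).toAddMonoidHom e hP x y = 0) : x = 0 := by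
  have hflip : ∀ y, coeffPairing (EisensteinCoeff.tailFormZMod p hm k).toAddMonoidHom e.flip hP y x = 0 := fun y => by
    rw [coeffPairing_flip _ e hP e.flip (fun a b => rfl)]; exact hx y
  exact coeffPairing_eq_zero_of_forall hm k e.flip hP he hflip

/-- **Surjectivity of the first-slot dual map**: if every additive `φ : M₂ → P` is `e(w, ·)`, then every additive
`F : M₂ ⊗ A_{m,k} → P` is `B(x, ·)` — take `x = ∑ᵢ [T^i] ⊗ wᵢ` with `e(wᵢ, ·) = F([πᵢ^*] ⊗ ·)`.
[cite: Howard2004HeegnerKolyvagin, §1.3 (H.4, «perfect») and Lemma 2.1.1] -/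
theorem coeffPairing_left_surjective (he : ∀ φ : M₂ →+ P, ∃ w : M₁, ∀ b : M₂, e w b = φ b)
    (F : EisensteinCoeff.Twisted p m k M₂ →+ P) :
    ∃ x : EisensteinCoeff.Twisted p m k M₁, ∀ y, coeffPairing (EisensteinCoeff.tailFormZMod p hm k).toAddMonoidHom e hP x y = F y := by
  have hφ : ∀ i : Fin m, ∃ w : M₁, ∀ b : M₂, e w b =
      F (EisensteinCoeff.Twisted.tmul (EisensteinCoeff.dualFamily p hm k i) b) := fun i =>
    he (F.comp (AddMonoidHom.mk' (fun b => EisensteinCoeff.Twisted.tmul (EisensteinCoeff.dualFamily p hm k i) b)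
      fun a b => EisensteinCoeff.Twisted.tmul_add _ a b))
  choose w hw using hφ
  refine ⟨∑ i : Fin m, EisensteinCoeff.Twisted.tmul
    (Ideal.Quotient.mk _ ((PowerSeries.X : IwasawaAlgebra p) ^ (i : ℕ)) : EisensteinCoeff p m k) (w i), fun y => ?_⟩
  obtain ⟨u, rfl⟩ := EisensteinCoeff.exists_eq_sum_tmul_dualFamily p hm y
  rw [← coeffPairing_flip _ e hP e.flip (fun a b => rfl), coeffPairing_sum_tmul_sum hm k e.flip hP u w, map_sum]
  exact Finset.sum_congr rfl fun j _ => hw j (u j)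

/-- The `A_{m,k}`-valued duality form of the Eisenstein levels: `scalarForm` at `𝒪 = A_{m,k}`, `ι = ofZMod`.
[cite: Howard2004HeegnerKolyvagin, Lemma 2.1.1 and §1.3 (H.4)] -/
abbrev eisensteinDualityForm (eb : M₁ →+ M₂ →+ ZMod (p ^ k)) :
    EisensteinCoeff.Twisted p m k M₁ →ₗ[EisensteinCoeff p m k] EisensteinCoeff.Twisted p m k M₂ →ₗ[EisensteinCoeff p m k]
      EisensteinCoeff p m k :=
  scalarForm (EisensteinCoeff.ofZMod p hm k) eb

/-- The tail form of the duality form is the `λ_k`-contracted pairing: `λ_k (e x y) = B_{λ_k, eb}(x, y)`.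
[cite: Howard2004HeegnerKolyvagin, §2.1 and Lemma 2.1.1] -/
theorem tailFormZMod_eisensteinDualityForm (eb : M₁ →+ M₂ →+ ZMod (p ^ k)) (x : EisensteinCoeff.Twisted p m k M₁)
    (y : EisensteinCoeff.Twisted p m k M₂) :
    EisensteinCoeff.tailFormZMod p hm k (eisensteinDualityForm hm k eb x y) =
      coeffPairing (EisensteinCoeff.tailFormZMod p hm k).toAddMonoidHom eb
        (fun q : ZMod (p ^ k) => by rw [nsmul_eq_mul, ZMod.natCast_self, zero_mul]) x y :=
  apply_scalarForm_eq_coeffPairing (EisensteinCoeff.ofZMod p hm k) eb (EisensteinCoeff.tailFormZMod p hm k).toAddMonoidHom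
    (fun z c => EisensteinCoeff.tailFormZMod_ofZMod_mul p hm k z c) x y

/-- **Perfectness of the `A_{m,k}`-valued duality form** (`R`-valued sense, the `perfect` field of the cell's
`DualityDatum`: `x ↦ e(x, ·)` is a bijection onto `Hom_{A_{m,k}}(M₂ ⊗ A_{m,k}, A_{m,k})`), for `eb : M₁ × M₂ → ℤ/p^k`
left-non-degenerate and exhausting the characters of `M₂` — via the reciprocity `Hom_{A}(·, A) ≅ Hom(·, ℤ/p^k)` of
`IwasawaAlgebraEisensteinQuotientReciprocity` and §3's coordinates. [cite: Howard2004HeegnerKolyvagin, §1.3 (H.4, «perfect») and §2.1] -/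
theorem eisensteinDualityForm_bijective (eb : M₁ →+ M₂ →+ ZMod (p ^ k)) (he₁ : ∀ w : M₁, (∀ b : M₂, eb w b = 0) → w = 0)
    (he₂ : ∀ φ : M₂ →+ ZMod (p ^ k), ∃ w : M₁, ∀ b : M₂, eb w b = φ b) :
    Function.Bijective (eisensteinDualityForm hm k eb) := by
  rw [EisensteinCoeff.bijective_iff_bijective_tailFormZModComp_comp p hm k]
  have hP : ∀ q : ZMod (p ^ k), (p ^ k) • q = 0 := fun q => by rw [nsmul_eq_mul, ZMod.natCast_self, zero_mul]
  have key : ∀ x y, EisensteinCoeff.tailFormZModComp p hm k (eisensteinDualityForm hm k eb x) y =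
      coeffPairing (EisensteinCoeff.tailFormZMod p hm k).toAddMonoidHom eb hP x y := fun x y =>
    tailFormZMod_eisensteinDualityForm hm k eb x y
  constructor
  · intro x x' h
    rw [← sub_eq_zero]
    refine coeffPairing_left_injective hm k eb hP he₁ fun y => ?_
    have hy := DFunLike.congr_fun h y
    simp only [key] at hy
    rw [map_sub, AddMonoidHom.sub_apply, hy, sub_self]
  · intro F
    obtain ⟨x, hx⟩ := coeffPairing_left_surjective hm k eb hP he₂ F
    exact ⟨x, AddMonoidHom.ext fun y => (key x y).trans (hx y)⟩

/-- **Symmetry** of the duality form on `M ⊗ A_{m,k}` for a symmetric `eb`. [cite: Howard2004HeegnerKolyvagin, §1.3 (H.4, «symmetric»)] -/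
theorem eisensteinDualityForm_symm {M : Type} [AddCommGroup M] (eb : M →+ M →+ ZMod (p ^ k))
    (heb : ∀ a b, eb a b = eb b a) (s t : EisensteinCoeff.Twisted p m k M) :
    eisensteinDualityForm hm k eb s t = eisensteinDualityForm hm k eb t s :=
  scalarForm_flip (EisensteinCoeff.ofZMod p hm k) eb eb (fun a b => heb b a) t s

end Perfect

/-! ## §4 Equivariance `e(s^g, t^{τ g τ⁻¹}) = χ(g) e(s, t)` for one Eisenstein twist on both slots -/

section Equivariant

variable {K : Type} [Field K] {p : ℕ} [hp : Fact p.Prime] {m : ℕ} (hm : 1 ≤ m) (k : ℕ) (κ' : ZpExtension K p)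
  {M : Type} [AddCommGroup M] [TopologicalSpace M] [DiscreteTopology M] (ρ : DiscreteGaloisModule K M)
  (c : absoluteGaloisGroup K → absoluteGaloisGroup K) (χbar : absoluteGaloisGroup K → ZMod (p ^ k))
  (eb : M →+ M →+ ZMod (p ^ k))
  (heb : ∀ (g : absoluteGaloisGroup K) (a b : M), eb (ρ g a) (ρ (c g) b) = χbar g * eb a b)
  (hκ : ∀ g : absoluteGaloisGroup K,
    p ^ eisensteinLevel (p := p) hm k ∣ κ'.twistExponent (eisensteinLevel (p := p) hm k) g +
      κ'.twistExponent (eisensteinLevel (p := p) hm k) (c g))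

/-- **Opposite exponents from anticyclotomicity**: if `κ'(c g) = κ'(g)⁻¹` for all `g` (e.g. `κ'` anticyclotomic and `c`
conjugation by a complex conjugation) then `p^J ∣ e_J(g) + e_J(c g)`. [cite: Howard2004HeegnerKolyvagin, §2.2 (the anticyclotomic character)]
[cite: Washington1997, §13.1–§13.2] -/
theorem twistExponent_add_twistExponent_conj_dvd (hanti : ∀ g : absoluteGaloisGroup K, (κ' (c g)).toAdd = -(κ' g).toAdd)
    (J : ℕ) (g : absoluteGaloisGroup K) : p ^ J ∣ κ'.twistExponent J g + κ'.twistExponent J (c g) := by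
  rw [← ZMod.natCast_eq_zero_iff, Nat.cast_add, twistExponent, twistExponent, ZMod.natCast_zmod_val,
    ZMod.natCast_zmod_val, hanti, map_neg, add_neg_cancel]

omit [TopologicalSpace M] [DiscreteTopology M] in
/-- `scalarFormHom` on the pinned pure tensors of `M ⊗ A_{m,k}`. [cite: Howard2004HeegnerKolyvagin, Lemma 2.1.1] -/
theorem scalarFormHom_twisted_tmul_tmul (ι : ZMod (p ^ k) →+* EisensteinCoeff p m k) (c₁ c₂ : EisensteinCoeff p m k)
    (a₁ a₂ : M) :
    scalarFormHom ι eb (EisensteinCoeff.Twisted.tmul c₁ a₁) (EisensteinCoeff.Twisted.tmul c₂ a₂) = c₁ * c₂ * ι (eb a₁ a₂) :=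
  scalarFormHom_tmul_tmul ι eb c₁ c₂ a₁ a₂

include heb hκ in
/-- **Equivariance of the duality form** (the `equivariant` field of the cell's `DualityDatum`, abstract normalisation):
`e (ρ' g s) (ρ' (c g) t) = ι(χ̄ g) * e s t` for `ρ' = κ'.eisensteinTwist ρ` on BOTH slots, `c g` on the second, given the
`E`-level equivariance of `eb` and opposite exponents (the unipotent factors `(1+T)^{e(g)} (1+T)^{e(cg)}` cancel).
[cite: Howard2004HeegnerKolyvagin, §1.3 (H.4: (s^σ, t^{τστ⁻¹}) = (s,t)^σ) and Lemma 2.1.1] -/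
theorem eisensteinDualityForm_equivariant (g : absoluteGaloisGroup K) (s t : EisensteinCoeff.Twisted p m k M) :
    eisensteinDualityForm hm k eb (κ'.eisensteinTwist ρ hm k g s) (κ'.eisensteinTwist ρ hm k (c g) t) =
      EisensteinCoeff.ofZMod p hm k (χbar g) * eisensteinDualityForm hm k eb s t := by
  rw [scalarForm_apply_apply, scalarForm_apply_apply]
  induction s using EisensteinCoeff.Twisted.induction_on with
  | zero => simp only [map_zero, AddMonoidHom.zero_apply, mul_zero]
  | tmul c₁ a₁ =>
    induction t using EisensteinCoeff.Twisted.induction_on with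
    | zero => simp only [map_zero, mul_zero]
    | tmul c₂ a₂ =>
      rw [eisensteinTwist_apply_tmul, eisensteinTwist_apply_tmul, scalarFormHom_twisted_tmul_tmul,
        scalarFormHom_twisted_tmul_tmul, heb, map_mul]
      have hu := onePlusT_pow_mul_onePlusT_pow_eq_one hm k (hκ g)
      calc _ = (IwasawaAlgebra.EisensteinCoeff.onePlusT p m k ^ κ'.twistExponent (eisensteinLevel (p := p) hm k) g *
            IwasawaAlgebra.EisensteinCoeff.onePlusT p m k ^ κ'.twistExponent (eisensteinLevel (p := p) hm k) (c g)) *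
          (EisensteinCoeff.ofZMod p hm k (χbar g) * (c₁ * c₂ * EisensteinCoeff.ofZMod p hm k (eb a₁ a₂))) := by ring
        _ = _ := by rw [hu, one_mul]
    | add y y' hy hy' => rw [map_add, map_add, map_add, hy, hy', mul_add]
  | add x x' hx hx' =>
    rw [map_add, map_add, AddMonoidHom.add_apply, map_add, AddMonoidHom.add_apply, hx, hx', mul_add]

include hκ in
/-- **Equivariance in the cyclotomic normalisation** — literally the `equivariant` field of
`Howard2004.DualityDatum`: with `χ̄ = χ_cyc mod p^k` (tree `cyclotomicCharacterModPow`),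
`e (ρ' g s) (ρ' (c g) t) = algebraMap ℤ_[p] A_{m,k} (χ_cyc g) * e s t`.
[cite: Howard2004HeegnerKolyvagin, §1.3 (H.4: (s^σ, t^{τστ⁻¹}) = (s,t)^σ)] -/
theorem eisensteinDualityForm_equivariant_cyclotomic
    (hebc : ∀ (g : absoluteGaloisGroup K) (a b : M),
      eb (ρ g a) (ρ (c g) b) = cyclotomicCharacterModPow K p k g * eb a b)
    (g : absoluteGaloisGroup K) (s t : EisensteinCoeff.Twisted p m k M) :
    eisensteinDualityForm hm k eb (κ'.eisensteinTwist ρ hm k g s) (κ'.eisensteinTwist ρ hm k (c g) t) =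
      algebraMap ℤ_[p] (EisensteinCoeff p m k) ((GaloisRep.cyclotomicCharacter K p g : ℤ_[p]ˣ) : ℤ_[p]) *
        eisensteinDualityForm hm k eb s t := by
  rw [EisensteinCoeff.algebraMap_padicInt_eq_ofZMod_toZModPow p hm k, ← cyclotomicCharacterModPow_apply]
  exact eisensteinDualityForm_equivariant hm k κ' ρ c (cyclotomicCharacterModPow K p k) eb hebc hκ g s t

end Equivariant

end ZpExtension

end Literature.NumberTheory.EllipticCurves
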